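import Literature.Barriers.CriticalPhenomena.PlaquetteWalkHoleRootThinBoxCells
import HarnessLib

/-!
# Barrier catalogue (SAWScalingLimit): THE ROOT NOTCH AT THE EAST RAY — `rootS` absent and the bottom line of the root row
shut east of the root plaquette ⇒ the under route is EMPTY

Leaf of `PlaquetteWalkHoleRootPrefixLoop` (§4, the prefix-loop separation lemma: an excursion through the bottom side of
`rootE w` forces the prefix through the bottom side of `w`) and `PlaquetteWalkHoleRootStructuralKill` (§10, the parity
law's odd eastern crossing is `w.S` or `rootE.S` when the bottom line of the root row is uncrossable for `x ≥ w.1 + 2`).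
Setting: root plaquette `w` rooted at `W`, hole `holeFaceW w = (w.1 − 1, w.2) ∉ D`, far cell `farW w`, `rootS w = (w.1, w.2 − 1)`,
`rootE w = (w.1 + 1, w.2)`, `rootN w = (w.1, w.2 + 1)`.

§1 ★★★★ `ΩG.AJ_root_eq_zero_of_under_rootS_east` / ★★★★★ `ΩG.WE_eq_excursionWinding_of_under_rootS_east` — **ROOT NOTCH
+ EAST RAY SHUT ⇒ NO WOUND UNDER-WALK**: hole and `rootS w` absent, `(x, w.2) ∉ D ∨ (x, w.2 − 1) ∉ D` for every `x ≥ w.1 + 2`.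
With `rootS` absent the bottom side of `w` is a dead door — no mid-edge of any walk; so the odd eastern crossing of a winding
excursion is the bottom side of `rootE w`, and then the prefix crosses `w.S` (PrefixLoop §4): impossible. Either orientation
of the winding witness. Row-mirror twin `ΩG.WE_eq_excursionWinding_of_over_rootN_east` (`rootN` absent, top line shut east of
`w.1 + 1` ⇒ no wound OVER-walk) by `ΩG.mirrorFar`. This is the lane's second untyped emptiness of the thin census (FINDING
§22 addendum / §24: «root plaquette one column off the east wall + `rootN` removed ⇒ no over witness ≤ 36 arcs», kit
j291139–43, j295595) — with no wall needed beyond the two cells of the ray's first column.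
§2 GENERIC ONE-ROUTE TOOLS (for this and every later emptiness): `ΩG.sum_routeMassW_eq_zero_of_unwound` (a route none of
whose walks is wound has mass `0`), `ΩG.killed_both_of_unwound` (both kill statements of LAW L hold vacuously for it),
★★★★ `im_vertexFunctional_printed_pos_of_under_unwound` / `im_vertexFunctional_printed_neg_of_over_unwound` (one route
unwound at every angle + abstract witnesses of both freenesses for the other ⇒ `Im VF > 0`, resp. `< 0`, on the whole range
`[π/3, 2π/3]`).
§3 Boxes: ★★★★★ `lawL_box_eastRootE_rootS_not_wound_under` — the root plaquette's eastern neighbour `(h.1 + 2, h.2)` in the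
LAST column (`h.1 + 3 = m`) and `rootS = (h.1 + 1, h.2 − 1)` removed ⇒ no wound under-walk, for ANY further defects `S ∋ h`
missing the far cell; `lawL_box_eastRootE_rootN_not_wound_over` (twin). (The one-route sign theorems for these boxes need two
witnesses inside `[1,5]×[0,4]` avoiding `rootS`, typed in the companion leaf.)

Not in print; venture lane «pcv-sawmu», seat b-step0 gen 28.

References: A. Glazman, I. Manolescu, arXiv:1708.00395v3, §1 (Fig. 1, Fig. 2, remark after eq. (1)), §2.1, §4.2, Lemma 2.1
[GlazmanManolescu2019]; A. Glazman, Electron. Commun. Probab. 20 (2015) no. 86, Lemma 3.1, proof pp. 6–7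
[Glazman2015WeightedSAW]; R. Courant, H. Robbins, *What is Mathematics?* (1941/1958), Ch. V Appendix §2 (the even–odd
rule) [CourantRobbins1958]; L. V. Ahlfors, *Complex Analysis*, 3rd ed. (1979), Ch. 4 §2.1 [AhlforsCA1979].
-/

noncomputable section

open Set Function Complex

namespace Literature.Probability.RandomPlanarGeometry.SAW.YangBaxter

open Real
open Literature.Barriers.CriticalPhenomena.PlaquetteWalk (mirrorRowFace)

open private side_jOut from Literature.Probability.RandomPlanarGeometry.YangBaxterSAWExcursionJordan

namespace ΩG

variable {D : Set Face} {w : Face}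

/-! ## §1 Root notch + east ray shut ⇒ no wound under-walk -/

/-- ★★★★ **ROOT NOTCH + EAST RAY SHUT ⇒ THE EXCURSION POLYGON OF AN UNDER-WALK DOES NOT WIND AROUND THE ROOT.** Hole and
`rootS w` absent, the bottom line of the root row uncrossable for `x ≥ w.1 + 2`; `ω` of class `B2a` with first side `S`.
The parity law's odd eastern crossing (`ΩG.exists_nth_eq_east_sides_of_AJ_ne_zero`) is `w.S` — a dead door, both of whose
faces a crossed mid-edge would put in `D` — or the bottom side of `rootE w`, which forces the PREFIX through `w.S`
(`ΩG.exists_prefix_nth_eq_root_S`): dead again. [cite: CourantRobbins1958, Ch. V Appendix §2 (The Jordan Curve Theorem for Polygons: the even–odd rule)]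
[cite: AhlforsCA1979, Ch. 4 §2.1 (index of a point with respect to a closed curve)]
[cite: Glazman2015WeightedSAW, Lemma 3.1 (proof, pp. 6–7: the classes of walks through a rhombus)] -/
theorem AJ_root_eq_zero_of_under_rootS_east (hh : holeFaceW w ∉ D)
    (hrow : ∀ x : ℤ, w.1 + 2 ≤ x → (x, w.2) ∉ D ∨ (x, w.2 - 1) ∉ D) (hRS : rootS w ∉ D)
    (ω : ΩG D (w.side .W) (farW w)) (hr : RootedFace D (w.side .W) (farW w)) (h : ω.IsB2a)
    (hS : ω.2.firstSideG = .S) : ω.AJ hr h (toC (midPt (w.side .W))) = 0 := by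
  have hF := ω.fh_lt h
  have h1 := ω.one_le_firstHitG_far
  by_contra hA
  obtain ⟨⟨i, hFi, hi1, hnth⟩, -⟩ := ω.exists_nth_eq_east_sides_of_AJ_ne_zero hh hrow hr h hA
  -- the bottom side of `w` is a dead door
  have hdead : ∀ k, 0 < k → k < ω.2.arcs.length → ω.2.nth k ≠ w.side .S := by
    intro k hk0 hk e
    have hd := ω.2.door_nth (j := k) hk0 hk
    rw [e, root_side_S_faces] at hd
    exact hRS hd.1
  rcases hnth with e | e
  · exact hdead (i + 1) (by omega) (by omega) e
  · have hJ : ∃ j, j < ω.Mv ∧ (ω.jFace h j).side (ω.jOut hr h j) = (rootE w).side .S := by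
      refine ⟨i - ω.2.firstHitG, by unfold ΩG.Mv; omega, ?_⟩
      rw [side_jOut (hr := hr) h (by unfold ΩG.Mv; omega),
        show ω.2.firstHitG + (i - ω.2.firstHitG) + 1 = i + 1 by omega, e, rootE_side_S]
    obtain ⟨i₀, hi₀1, hi₀F, hnth₀⟩ := exists_prefix_nth_eq_root_S hh hr h hS hJ
    exact hdead i₀ (by omega) (by omega) hnth₀

/-- ★★★★★ **ROOT NOTCH + EAST RAY SHUT ⇒ NO WOUND UNDER-WALK** (either orientation of the winding witness: the reversed
companion has the same prefix and first side). In every domain with the hole and `rootS w` absent and the bottom line of the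
root row uncrossable for `x ≥ w.1 + 2`, every class-`B2a` under-walk at the far cell is unwound.
[cite: GlazmanManolescu2019, Lemma 2.1 (statement, "in the form given in [Gl]"), §1 (Fig. 2)]
[cite: Glazman2015WeightedSAW, Lemma 3.1 (proof, pp. 6–7)] [cite: CourantRobbins1958, Ch. V Appendix §2 (the even–odd rule)] -/
theorem WE_eq_excursionWinding_of_under_rootS_east (hh : holeFaceW w ∉ D)
    (hrow : ∀ x : ℤ, w.1 + 2 ≤ x → (x, w.2) ∉ D ∨ (x, w.2 - 1) ∉ D) (hRS : rootS w ∉ D)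
    (ω : ΩG D (w.side .W) (farW w)) (hr : RootedFace D (w.side .W) (farW w)) (h : ω.IsB2a)
    (hS : ω.2.firstSideG = .S) (θ : ℝ) :
    ω.WE (fun _ => θ) = excursionWinding θ ω.2.firstSideG (ω.z1 hr h) ω.1 := by
  by_contra hW
  rcases ω.AJ_ne_zero_or_rev_of_wound hr h θ hW with hA | hA
  · exact hA (AJ_root_eq_zero_of_under_rootS_east hh hrow hRS ω hr h hS)
  · have h' := ω.rev_isB2a hr h
    have hS' : (ω.rev hr).2.firstSideG = .S := by rw [ω.rev_firstSide hr h]; exact hS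
    exact hA (AJ_root_eq_zero_of_under_rootS_east hh hrow hRS (ω.rev hr) hr h' hS')

/-- ★★★★★ **ROOT NOTCH ABOVE + EAST RAY SHUT ⇒ NO WOUND OVER-WALK** (row-mirror twin): hole and `rootN w = (w.1, w.2 + 1)`
absent, the top line of the root row uncrossable for `x ≥ w.1 + 2` (`(x, w.2) ∉ D ∨ (x, w.2 + 1) ∉ D`) ⇒ every class-`B2a`
over-walk (first side `N`) at the far cell is unwound. Transport through `ΩG.mirrorFar`.
[cite: GlazmanManolescu2019, §1 (Fig. 1, Fig. 2), §4.2 (lattice symmetries), Lemma 2.1]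
[cite: Glazman2015WeightedSAW, Lemma 3.1 (proof, pp. 6–7)] [cite: CourantRobbins1958, Ch. V Appendix §2 (the even–odd rule)] -/
theorem WE_eq_excursionWinding_of_over_rootN_east (hh : holeFaceW w ∉ D)
    (hrow : ∀ x : ℤ, w.1 + 2 ≤ x → (x, w.2) ∉ D ∨ (x, w.2 + 1) ∉ D) (hRN : rootN w ∉ D)
    (ω : ΩG D (w.side .W) (farW w)) (hr : RootedFace D (w.side .W) (farW w)) (h : ω.IsB2a)
    (hN : ω.2.firstSideG = .N) (θ : ℝ) :
    ω.WE (fun _ => θ) = excursionWinding θ ω.2.firstSideG (ω.z1 hr h) ω.1 := by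
  by_contra hW
  have hr' := rootedFace_rowMirrorDom w hr
  have h' := ω.mirrorFar_isB2a hr h
  have hh' : holeFaceW w ∉ rowMirrorDom w D := by rwa [mem_rowMirrorDom, mirrorRowFace_holeFaceW]
  have hRS' : rootS w ∉ rowMirrorDom w D := by rwa [mem_rowMirrorDom, mirrorRowFace_rootS]
  have hrow' : ∀ x : ℤ, w.1 + 2 ≤ x → (x, w.2) ∉ rowMirrorDom w D ∨ (x, w.2 - 1) ∉ rowMirrorDom w D := by
    intro x hx
    rw [mem_rowMirrorDom, mem_rowMirrorDom, mirrorRowFace_row, mirrorRowFace_row_pred]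
    exact hrow x hx
  have hS' : ω.mirrorFar.2.firstSideG = .S := by rw [mirrorFar_firstSideG, hN]; rfl
  exact absurd (WE_eq_excursionWinding_of_under_rootS_east hh' hrow' hRS' ω.mirrorFar hr' h' hS' _)
    (ω.mirrorFar_wound hr h hW)

/-! ## §2 Generic one-route tools: a route with no wound walk -/

/-- **A ROUTE NONE OF WHOSE WALKS IS WOUND HAS MASS ZERO** (at the given angle). [cite: GlazmanManolescu2019, Lemma 2.1 (statement, "in the form given in [Gl]")] -/
theorem sum_routeMassW_eq_zero_of_unwound [Finite D] (hr : RootedFace D (w.side .W) (farW w)) (s : Side) (θ : ℝ)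
    (hU : ∀ (ω : ΩG D (w.side .W) (farW w)) (h : ω.IsB2a), ω.2.firstSideG = s →
      ω.WE (fun _ => θ) = excursionWinding θ ω.2.firstSideG (ω.z1 hr h) ω.1) :
    ∑ ω ∈ setB2a D (w.side .W) (farW w), routeMassW θ hr s ω = 0 := by
  classical
  refine Finset.sum_eq_zero fun ω _ => ?_
  unfold routeMassW
  split_ifs with h1 h2
  · exact absurd (hU ω h1 h2.1) h2.2
  · rfl
  · rfl

/-- **Both kill statements of LAW L hold VACUOUSLY for a route with no wound walk** (any freeness predicate `P`).
[cite: GlazmanManolescu2019, §1 (Fig. 2 and the remark after eq. (1))] -/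
theorem killed_of_unwound (hr : RootedFace D (w.side .W) (farW w)) (s : Side) (θ : ℝ)
    (hU : ∀ (ω : ΩG D (w.side .W) (farW w)) (h : ω.IsB2a), ω.2.firstSideG = s →
      ω.WE (fun _ => θ) = excursionWinding θ ω.2.firstSideG (ω.z1 hr h) ω.1)
    (P : ΩG D (w.side .W) (farW w) → Prop) :
    ∀ (ω : ΩG D (w.side .W) (farW w)) (h : ω.IsB2a), ω.2.firstSideG = s →
      ω.WE (fun _ => θ) ≠ excursionWinding θ ω.2.firstSideG (ω.z1 hr h) ω.1 → ¬P ω :=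
  fun ω h hs hW => absurd (hU ω h hs) hW

end ΩG

end Literature.Probability.RandomPlanarGeometry.SAW.YangBaxter

namespace Literature.Barriers.CriticalPhenomena.PlaquetteWalk

open Literature.Probability.RandomPlanarGeometry.SAW.YangBaxter
open Real Complex

section OneRoute

variable {Dl : List Face} {w : Face}

/-- ★★★★ **UNDER ROUTE UNWOUND AT EVERY ANGLE + OVER WITNESSES OF BOTH KINDS ⇒ `Im VF(θ) > 0` ON THE WHOLE RANGE** — the
generic form of the lane's one-route sign theorems (`VF = i·v·(M_N − M_S)` with `M_S ≡ 0`; at `π/3` the `w₂`-free over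
witness, at `2π/3` the `w₁`-free one, inside the range any wound over-walk weighs positively).
[cite: GlazmanManolescu2019, Lemma 2.1 (statement, "in the form given in [Gl]"), §1 eq. (1)]
[cite: Glazman2015WeightedSAW, Lemma 3.1 (proof, pp. 6–7)] -/
theorem im_vertexFunctional_printed_pos_of_under_unwound {θ : ℝ} (hθ : θ ∈ Set.Icc (π / 3) (2 * π / 3))
    (hf : farW w ∈ Dl) (hh : holeFaceW w ∉ dom Dl) (hr : RootedFace (dom Dl) (w.side .W) (farW w))
    (hU : ∀ (θ' : ℝ) (ω : ΩG (dom Dl) (w.side .W) (farW w)) (h : ω.IsB2a), ω.2.firstSideG = .S →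
      ω.WE (fun _ => θ') = excursionWinding θ' ω.2.firstSideG (ω.z1 hr h) ω.1)
    (hO2 : ∀ θ' : ℝ, ∃ (ω : ΩG (dom Dl) (w.side .W) (farW w)) (h : ω.IsB2a), ω.2.firstSideG = .N ∧
      ω.WE (fun _ => θ') ≠ excursionWinding θ' ω.2.firstSideG (ω.z1 hr h) ω.1 ∧ ω.2.W2FreeOff (farW w))
    (hO1 : ∀ θ' : ℝ, ∃ (ω : ΩG (dom Dl) (w.side .W) (farW w)) (h : ω.IsB2a), ω.2.firstSideG = .N ∧
      ω.WE (fun _ => θ') ≠ excursionWinding θ' ω.2.firstSideG (ω.z1 hr h) ω.1 ∧ ω.2.W1FreeOff (farW w)) :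
    0 < (vertexFunctional (printedWeights θ) tFiveEighths (ybCoeff θ) Dl (w.side .W) (farW w)).im := by
  rcases eq_or_lt_of_le hθ.1 with e1 | h1
  · rw [← e1]
    exact im_vertexFunctional_printed_farCellW_pi_div_three_pos_of_under_killed Dl w hf hh hr
      (ΩG.killed_of_unwound hr .S _ (hU _) fun ω => ω.2.W2FreeOff (farW w)) (hO2 _)
  rcases eq_or_lt_of_le hθ.2 with e2 | h2
  · rw [e2]
    exact im_vertexFunctional_printed_farCellW_two_pi_div_three_pos_of_under_killed Dl w hf hh hr
      (ΩG.killed_of_unwound hr .S _ (hU _) fun ω => ω.2.W1FreeOff (farW w)) (hO1 _)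
  have hθo : θ ∈ Set.Ioo (π / 3) (2 * π / 3) := ⟨h1, h2⟩
  rw [vertexFunctional_printed_farCellW_im_eq hθ Dl w hf hh hr, ΩG.sum_routeMassW_eq_zero_of_unwound hr .S θ (hU θ),
    sub_zero]
  obtain ⟨ω, h, hN, hW, -⟩ := hO2 θ
  exact mul_pos (weightV_pos_of_mem_Ioo ⟨by linarith [hθo.1, Real.pi_pos], by linarith [hθo.2, Real.pi_pos]⟩)
    (ΩG.sum_routeMassW_pos_of_wound hr .N hθo ⟨ω, h, hN, hW⟩)

/-- ★★★★ **OVER ROUTE UNWOUND AT EVERY ANGLE + UNDER WITNESSES OF BOTH KINDS ⇒ `Im VF(θ) < 0` ON THE WHOLE RANGE.**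
[cite: GlazmanManolescu2019, Lemma 2.1 (statement, "in the form given in [Gl]"), §1 eq. (1)]
[cite: Glazman2015WeightedSAW, Lemma 3.1 (proof, pp. 6–7)] -/
theorem im_vertexFunctional_printed_neg_of_over_unwound {θ : ℝ} (hθ : θ ∈ Set.Icc (π / 3) (2 * π / 3))
    (hf : farW w ∈ Dl) (hh : holeFaceW w ∉ dom Dl) (hr : RootedFace (dom Dl) (w.side .W) (farW w))
    (hU : ∀ (θ' : ℝ) (ω : ΩG (dom Dl) (w.side .W) (farW w)) (h : ω.IsB2a), ω.2.firstSideG = .N →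
      ω.WE (fun _ => θ') = excursionWinding θ' ω.2.firstSideG (ω.z1 hr h) ω.1)
    (hU2 : ∀ θ' : ℝ, ∃ (ω : ΩG (dom Dl) (w.side .W) (farW w)) (h : ω.IsB2a), ω.2.firstSideG = .S ∧
      ω.WE (fun _ => θ') ≠ excursionWinding θ' ω.2.firstSideG (ω.z1 hr h) ω.1 ∧ ω.2.W2FreeOff (farW w))
    (hU1 : ∀ θ' : ℝ, ∃ (ω : ΩG (dom Dl) (w.side .W) (farW w)) (h : ω.IsB2a), ω.2.firstSideG = .S ∧
      ω.WE (fun _ => θ') ≠ excursionWinding θ' ω.2.firstSideG (ω.z1 hr h) ω.1 ∧ ω.2.W1FreeOff (farW w)) :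
    (vertexFunctional (printedWeights θ) tFiveEighths (ybCoeff θ) Dl (w.side .W) (farW w)).im < 0 := by
  rcases eq_or_lt_of_le hθ.1 with e1 | h1
  · rw [← e1]
    exact im_vertexFunctional_printed_farCellW_pi_div_three_neg_of_over_killed Dl w hf hh hr
      (ΩG.killed_of_unwound hr .N _ (hU _) fun ω => ω.2.W2FreeOff (farW w)) (hU2 _)
  rcases eq_or_lt_of_le hθ.2 with e2 | h2
  · rw [e2]
    exact im_vertexFunctional_printed_farCellW_two_pi_div_three_neg_of_over_killed Dl w hf hh hr
      (ΩG.killed_of_unwound hr .N _ (hU _) fun ω => ω.2.W1FreeOff (farW w)) (hU1 _)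
  have hθo : θ ∈ Set.Ioo (π / 3) (2 * π / 3) := ⟨h1, h2⟩
  rw [vertexFunctional_printed_farCellW_im_eq hθ Dl w hf hh hr, ΩG.sum_routeMassW_eq_zero_of_unwound hr .N θ (hU θ),
    zero_sub, mul_neg, neg_lt_zero]
  obtain ⟨ω, h, hS, hW, -⟩ := hU2 θ
  exact mul_pos (weightV_pos_of_mem_Ioo ⟨by linarith [hθo.1, Real.pi_pos], by linarith [hθo.2, Real.pi_pos]⟩)
    (ΩG.sum_routeMassW_pos_of_wound hr .S hθo ⟨ω, h, hS, hW⟩)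

end OneRoute

/-! ## §3 Boxes: the root plaquette's eastern neighbour in the last column -/

section Boxes

variable {m n : ℕ} {S : List Face} {h : Face}

/-- ★★★★★ **ALL BOXES: the cell east of the root plaquette in the LAST column (`h.1 + 3 = m`) and `rootS = (h.1 + 1, h.2 − 1)`
removed ⇒ NO WOUND UNDER-WALK** at the far cell of the root plaquette `(h.1 + 1, h.2)`, whatever else `S ∋ h` removes (far
cell kept): the bottom line of the root row is shut from column `h.1 + 3 = m` on (outside the box). The lane's kit datum
(j295595, frame `[1,5]×[0,4]`: `US2`/`US1` NONE with `(4,1)` removed; j291139–43 with the east side cut) for all boxes.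
[cite: GlazmanManolescu2019, Lemma 2.1 (statement, "in the form given in [Gl]"), §2.1]
[cite: Glazman2015WeightedSAW, Lemma 3.1 (proof, pp. 6–7)] [cite: CourantRobbins1958, Ch. V Appendix §2 (the even–odd rule)] -/
theorem lawL_box_eastRootE_rootS_not_wound_under (hW : 1 ≤ h.1) (hE3 : h.1 + 3 = m) (hS0 : 0 ≤ h.2) (hN : h.2 + 1 ≤ n)
    (hh : h ∈ S) (hfS : ((h.1 - 1, h.2) : Face) ∉ S) (hc : ((h.1 + 1, h.2 - 1) : Face) ∈ S)
    (ω : ΩG (dom (boxMinus m n S)) (Face.side (h.1 + 1, h.2) .W) (farW (h.1 + 1, h.2))) (hb : ω.IsB2a)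
    (hS : ω.2.firstSideG = .S) (θ : ℝ) :
    ω.WE (fun _ => θ) = excursionWinding θ ω.2.firstSideG
      (ω.z1 (rootedFace_hroot_boxMinus_of_mem (farW_hroot_mem_boxMinus_of_not_mem hW (by omega) hS0 hN hfS) hh) hb)
      ω.1 := by
  refine ΩG.WE_eq_excursionWinding_of_under_rootS_east ?_ (fun x hx => Or.inl fun hm => ?_) ?_ ω _ hb hS θ
  · rw [holeFaceW_hroot]; exact not_mem_dom_boxMinus_of_mem hh
  · obtain ⟨hb', -⟩ := mem_dom_boxMinus.1 hm
    simp only at hb' hx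
    omega
  · have e : rootS ((h.1 + 1, h.2) : Face) = (h.1 + 1, h.2 - 1) := Prod.ext (by simp only [rootS]) rfl
    rw [e]; exact not_mem_dom_boxMinus_of_mem hc

/-- ★★★★★ **ALL BOXES, TWIN: `h.1 + 3 = m` and `rootN = (h.1 + 1, h.2 + 1)` removed ⇒ NO WOUND OVER-WALK.**
[cite: GlazmanManolescu2019, Lemma 2.1 (statement, "in the form given in [Gl]"), §2.1, §4.2]
[cite: Glazman2015WeightedSAW, Lemma 3.1 (proof, pp. 6–7)] [cite: CourantRobbins1958, Ch. V Appendix §2 (the even–odd rule)] -/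
theorem lawL_box_eastRootE_rootN_not_wound_over (hW : 1 ≤ h.1) (hE3 : h.1 + 3 = m) (hS0 : 0 ≤ h.2) (hN : h.2 + 1 ≤ n)
    (hh : h ∈ S) (hfS : ((h.1 - 1, h.2) : Face) ∉ S) (hc : ((h.1 + 1, h.2 + 1) : Face) ∈ S)
    (ω : ΩG (dom (boxMinus m n S)) (Face.side (h.1 + 1, h.2) .W) (farW (h.1 + 1, h.2))) (hb : ω.IsB2a)
    (hN' : ω.2.firstSideG = .N) (θ : ℝ) :
    ω.WE (fun _ => θ) = excursionWinding θ ω.2.firstSideG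
      (ω.z1 (rootedFace_hroot_boxMinus_of_mem (farW_hroot_mem_boxMinus_of_not_mem hW (by omega) hS0 hN hfS) hh) hb)
      ω.1 := by
  refine ΩG.WE_eq_excursionWinding_of_over_rootN_east ?_ (fun x hx => Or.inl fun hm => ?_) ?_ ω _ hb hN' θ
  · rw [holeFaceW_hroot]; exact not_mem_dom_boxMinus_of_mem hh
  · obtain ⟨hb', -⟩ := mem_dom_boxMinus.1 hm
    simp only at hb' hx
    omega
  · have e : rootN ((h.1 + 1, h.2) : Face) = (h.1 + 1, h.2 + 1) := Prod.ext (by simp only [rootN]) rfl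
    rw [e]; exact not_mem_dom_boxMinus_of_mem hc

end Boxes

end Literature.Barriers.CriticalPhenomena.PlaquetteWalk
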